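import Summits.ResolutionOfSingularities.ResolutionOfSingularities.Theorems.HugValuationCutClasses
import Summits.ResolutionOfSingularities.ResolutionOfSingularities.Theorems.ContactShadowKernels
import Summits.ResolutionOfSingularities.ResolutionOfSingularities.Theorems.NearPointCutKernels
import HarnessLib

/-!
# HugValuationCutKernels — §5 (+ the proved lemmas of §3) of the decomp-res node «HugValuationCut» (lens-4
g14, sha256 52ca7cd9298143bb;
critic row 91 CLEARED)

Tree file 3/4, route-independent [WRITER NOTE: the lens's `singularSurface_iff_noTower` / `noTower_iff_perfect_and_imperfect` /
`noTowerImperfect_mono` are the tree's `NearPointCut.singularSurface_iff_noTower` / `ContactShadowKernels.noTower_iff_columns` /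
`ContactShadowKernels.noTowerImperfect_mono`, opened BY NAME]: §5 `pieces_of_singularSurface`, the certified EQUIV
`singularSurface_iff_pieces` (mod
`ShadowPort`), the
DECIDED column `discretePerfect_of_law` ((D-perf), engine (P3) Jacobian–conductor descent as the port `DiscreteShadowLaw`),
`singularSurface_of_g14` / `singularSurfacePerfect_of_g14`, and the PROVED structure of a dense shadow
(`HugShadow.exists_dominatedBy`,
`dominatedBy_of_le`, `not_isZValued_of_lt`, `creep`, `mem_iUnion_of_isZValued`) — VERBATIM.
(Sources: ZariskiSamuelII Ch. VI; CossartJannsenSaito2020; Lipman1978.)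
-/

noncomputable section

open CategoryTheory AlgebraicGeometry IsLocalRing
open Literature.AlgebraicGeometry.Resolution
open Summit.ResolutionOfSingularities.ResolutionOfSingularities.Theorems
open WeakOrderReduction ForcedTowerClasses DivergentTowerClasses MonomialTowerClasses
open HugDimensionClasses HugDimensionKernels SurfaceShadowClasses SurfaceShadowKernels
open ContactShadowClasses (NoTowerImperfect)
open ContactShadowKernels (noTowerImperfect_of_noTower noTowerImperfect_mono noTower_iff_columns)
open NearPointCut (SingularClass singularSurface_iff_noTower)

namespace Summit.ResolutionOfSingularities.ResolutionOfSingularities.Theorems.HugValuationCut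

/-! ## §5 Kernels (PROVED) -/

/-- Necessity, PORT-FREE: the target implies every piece (each piece is a sub-class of a sub-column). [folklore] -/
theorem pieces_of_singularSurface {n : ℕ} (h : SingularSurfaceHuggingTowersTerminate n) :
    DiscreteShadowTowersTerminate n ∧ DiscretePerfectShadowTowersTerminate n ∧
      DiscreteImperfectShadowTowersTerminate n ∧ DenseShadowTowersTerminate n := by
  have hD : DiscreteShadowTowersTerminate n := noTower_mono (fun _ h' => h'.1) h
  exact ⟨hD, ((noTower_iff_columns _).mp hD).1, ((noTower_iff_columns _).mp hD).2,
    noTower_mono (fun _ h' => h'.1) h⟩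

/-- **KERNEL — THE EXACT VALUATION-TYPE CUT of the singular-surface leaf 32260** (modulo the COSTUME port):
`SingularSurfaceHuggingTowersTerminate n ⟺ (D-perf) ∧ (D-imp) ∧ (Z)`.  Sufficiency: take the shadow; either some
dominating valuation ring of the shadow chain is `ℤ`-valued — the discrete column, bisected by perfectness of `k` — or
none is — the dense column. [folklore] -/
theorem singularSurface_iff_pieces {n : ℕ} (hP : ShadowPort n) :
    SingularSurfaceHuggingTowersTerminate n ↔
      DiscretePerfectShadowTowersTerminate n ∧ DiscreteImperfectShadowTowersTerminate n ∧
        DenseShadowTowersTerminate n := by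
  refine ⟨fun h => ⟨(pieces_of_singularSurface h).2.1, (pieces_of_singularSurface h).2.2.1,
    (pieces_of_singularSurface h).2.2.2⟩, ?_⟩
  rintro ⟨h₁, h₂, h₃⟩
  have hD : DiscreteShadowTowersTerminate n := (noTower_iff_columns _).mpr ⟨h₁, h₂⟩
  intro p hp k _ _ T g hB hDat hE hS
  obtain ⟨S⟩ := hP p hp k T g hB hDat hE hS.2.1 hS.2.2.1
  by_cases hd : DiscreteShadow T
  · exact hD p hp k T g hB hDat hE ⟨hS, hd⟩
  · exact h₃ p hp k T g hB hDat hE ⟨hS, ⟨S⟩, hd⟩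

/-- **KERNEL — (D-perf) THE DISCRETE COLUMN OVER PERFECT FIELDS IS DECIDED by the engine**: a regular member of
the shadow chain is a regular surface hug (dictionary), excluded by the class. [folklore] -/
theorem discretePerfect_of_law {n : ℕ} (hL : DiscreteShadowLaw n) : DiscretePerfectShadowTowersTerminate n := by
  intro p hp k _ _ _ T g hB hD hE hT
  obtain ⟨hS, S, V, hV, hZ⟩ := hT
  obtain ⟨i, hi⟩ := hL p hp k T g hB hD hE S V hV hZ
  exact hS.2.2.2 (S.regular ⟨i, hi⟩)

/-- **KERNEL — THE TARGET LEAF FROM THE TWO RESIDUALS, modulo the port and the engine.** [folklore] -/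
theorem singularSurface_of_g14 {n : ℕ} (hP : ShadowPort n) (hL : DiscreteShadowLaw n)
    (hI : DiscreteImperfectShadowTowersTerminate n) (hZ : DenseShadowTowersTerminate n) :
    SingularSurfaceHuggingTowersTerminate n :=
  (singularSurface_iff_pieces hP).2 ⟨discretePerfect_of_law hL, hI, hZ⟩

/-- Over PERFECT ground fields the residual is the dense column ALONE (modulo port + engine). [folklore] -/
theorem singularSurfacePerfect_of_g14 {n : ℕ} (hP : ShadowPort n) (hL : DiscreteShadowLaw n)
    (hZ : DenseShadowTowersTerminate n) : NoTowerPerfect n SingularClass := by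
  intro p hp k _ _ _ T g hB hDat hE hS
  obtain ⟨S⟩ := hP p hp k T g hB hDat hE hS.2.1 hS.2.2.1
  by_cases hd : DiscreteShadow T
  · exact discretePerfect_of_law hL p hp k T g hB hDat hE ⟨hS, hd⟩
  · exact hZ p hp k T g hB hDat hE ⟨hS, ⟨S⟩, hd⟩

/-! ### The located residual: PROVED structure of a dense shadow -/

namespace HugShadow

variable {T : ForcedTower} (S : HugShadow T)

/-- **(Z1) a dominating valuation ring exists** (Chevalley, PROVED). [folklore] -/
theorem exists_dominatedBy : ∃ V : ValuationSubring S.K, S.C.DominatedBy V :=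
  S.C.exists_dominatedBy

/-- **(Z2) in the class `¬ CurveHugging`, domination passes to every coarsening `≠ K`** (PROVED from V3 and the
curve dictionary) — with (R) of the docstring: every dominating valuation ring has rank one. [folklore] -/
theorem dominatedBy_of_le (hT : ¬ CurveHugging T) {V V' : ValuationSubring S.K} (hV : S.C.DominatedBy V)
    (hle : V ≤ V') (htop : V' ≠ ⊤) : S.C.DominatedBy V' :=
  S.C.dominatedBy_of_le hV hle htop fun hc => hT (S.curve hc)

/-- **(Z2′) … and no proper coarsening `≠ K` of a dominating ring is `ℤ`-valued** (PROVED). [folklore] -/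
theorem not_isZValued_of_lt (hT : ¬ CurveHugging T) {V V' : ValuationSubring S.K} (hV : S.C.DominatedBy V)
    (hle : V ≤ V') (hne : V ≠ V') (htop : V' ≠ ⊤) : ¬ IsZValued V' :=
  S.C.not_isZValued_of_lt hV hle hne htop fun hc => hT (S.curve hc)

/-- **(Z3) a dense shadow has NO `ℤ`-valued dominating ring, and every real-valued dominating valuation with dense
values CREEPS** (`inf_i min v(𝔪_i) = 0`, PROVED as `HugChain.creep`); restated at the shadow. [folklore] -/
theorem creep {V : ValuationSubring S.K} (hV : S.C.DominatedBy V) (v : S.K → ℝ)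
    (hmul : ∀ x y : S.K, x ≠ 0 → y ≠ 0 → v (x * y) = v x + v y)
    (hcut : ∀ x : S.K, x ≠ 0 → (x ∈ V ↔ 0 ≤ v x))
    (hdense : ∀ ε : ℝ, 0 < ε → ∃ g ∈ V, g ≠ 0 ∧ 0 < v g ∧ v g < ε) :
    ∀ ε : ℝ, 0 < ε → ∃ i, ∃ z ∈ S.C.R i, z ≠ 0 ∧ z⁻¹ ∉ S.C.R i ∧ v z < ε :=
  S.C.creep hV v hmul hcut hdense

/-- **(D0) a discrete shadow's dominating ring is the UNION of the shadow chain** (PROVED value descent) — the first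
step of the engine (P3): the marked points ARE the centres of the arc `Spec V → Σ`. [folklore] -/
theorem mem_iUnion_of_isZValued {V : ValuationSubring S.K} (hV : S.C.DominatedBy V) (hZ : IsZValued V) :
    ∀ f ∈ V, ∃ i, f ∈ S.C.R i :=
  S.C.mem_iUnion_of_isZValued hV hZ

end HugShadow

end Summit.ResolutionOfSingularities.ResolutionOfSingularities.Theorems.HugValuationCut

end
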